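import Summits.KontsevichZagierPeriods.KontsevichZagierPeriods.Theses.FermatIsogeny
import Summits.KontsevichZagierPeriods.KontsevichZagierPeriods.Theorems.FermatIsogenyBetaLinearSectorThirds
import Summits.KontsevichZagierPeriods.KontsevichZagierPeriods.Theorems.FermatIsogenyBetaLinearSectorQuartersStubBetaValues
import Summits.KontsevichZagierPeriods.KontsevichZagierPeriods.Theorems.FermatIsogenyBetaLinearSectorQuartersBridges
import Literature.NumberTheory.Transcendental.KontsevichZagierGammaProofs

/-!
# `BetaLinearSector` on the QUARTER-INTEGER sector, UNCONDITIONALLY (level `4`: the lemniscatic sector)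

Crux `BetaLinearSector` (stmt-KontsevichZagierPeriods-3897, route FermatIsogeny): two one-dimensional Kontsevich–Zagier representations
pinned on `(0,1)` as `[t^{a-1}(1-t)^{b-1}]` and `[c·t^{a'-1}(1-t)^{b'-1}]` (`a b a' b'` positive rationals, `c` real algebraic) with the same
value are KZ-equivalent.  THIS file proves it UNCONDITIONALLY on the sector `a, b, a', b' ∈ ¼ℕ_{>0}` — the registered anchor
`betaLinearSector_quarters` — where the Beta values fall into the four classes `ℚ̄·1`, `ℚ̄·π`, `ℚ̄·Γ(1/4)²/√π`, `ℚ̄·π^{3/2}/Γ(1/4)²`,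
separated by CHUDNOVSKY's theorem "`π` and `Γ(1/4)` are algebraically independent" (PROVED in the tree,
`algebraicIndependent_real_pi_gamma_one_quarter`) through the landed `Thirds.monomial_ne_algebraic_mul_monomial` after squaring away `√π`.
NEW at level `4` are two intra-class coincidences, realised by moves in `…QuartersBridges.lean`: Euler's reflection at `1/4`
(`B(1/4,3/4) = √2·B(1/2,1/2)`, `pinned_quarter_threeQuarter_equivalent`) and Legendre's duplication (`B(1/4,1/4) = √2·B(1/4,1/2)`,
`B(3/4,3/4) = B(3/4,1/2)/√2`, `pinned_duplication`).  NORMAL FORM: every base cell is a chain of moves away from `(c q)·T_i`, `T_0 = [β(1,1)]`,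
`T_1 = [β(1/2,1/2)]`, `T_2 = [√2·β(1/4,1/2)]`, `T_3 = [(4√2)⁻¹·β(3/4,1/2)]`, values `v = (1, π, Γ(1/4)²/√π, π√π/Γ(1/4)²)` (`stub_betaValuesQuarter`).
Hence **Conjecture 1 of Kontsevich–Zagier for every pair of Beta integrals with parameters in `¼ℤ`**, unconditionally.
References: M. Kontsevich, D. Zagier, *Periods* (2001), §1.2; G. V. Chudnovsky, *Contributions to the theory of transcendental numbers*
(1984), Ch. 7 §2 Cor. 2.3; G. E. Andrews, R. Askey, R. Roy, *Special Functions* (1999), §1.1, Thm 1.2.1, Thm 1.5.1.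
-/

noncomputable section
namespace Summit.KontsevichZagierPeriods.FermatIsogeny.BetaLinearSector.Quarters
open MeasureTheory Set Literature.NumberTheory.Transcendental Literature.NumberTheory.Transcendental.KZ HalfIntegers
open Summit.KontsevichZagierPeriods.FermatIsogeny.BetaLinearSector.Thirds (nf_a_one monomial_ne_algebraic_mul_monomial)

set_option quotPrecheck false in
/-- `r` is PINNED as `[(0,1), c · t^{a-1}(1-t)^{b-1}]` (the two hypotheses on each representation in the crux, with a constant). -/
local notation "Pinned⟦" c ", " a ", " b ", " r "⟧" =>
  (IntegralRep.domain r = {x : Fin 1 → ℝ | x 0 ∈ Set.Ioo (0:ℝ) 1} ∧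
    Set.EqOn (IntegralRep.integrand r) (fun x : Fin 1 → ℝ => (c : ℝ) * (x 0) ^ (((a : ℚ) : ℝ) - 1) * (1 - x 0) ^ (((b : ℚ) : ℝ) - 1))
      (IntegralRep.domain r))

set_option quotPrecheck false in
/-- The two-sided, constant-carrying form of the crux for fixed exponents: any two representations pinned as `[c·β(a,b)]`,
`[c'·β(a',b')]` (`c, c'` real algebraic) with equal values are KZ-equivalent. -/
local notation "P⟦" a ", " b ", " a' ", " b' "⟧" =>
  (∀ (c c' : ℝ) (r r' : IntegralRep 1), IsAlgebraic ℚ c → IsAlgebraic ℚ c' →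
    Pinned⟦c, a, b, r⟧ → Pinned⟦c', a', b', r'⟧ → IntegralRep.value r = IntegralRep.value r' → Equivalent r r')

set_option quotPrecheck false in
/-- The four CLASS VALUES at level `4`: `v = (1, π, Γ(1/4)²/√π, π√π/Γ(1/4)²)` (a notation, not a definition). -/
local notation "vq" => (![1, Real.pi, Real.Gamma (1/4) ^ 2 / Real.sqrt Real.pi, Real.pi * Real.sqrt Real.pi / Real.Gamma (1/4) ^ 2] :
  Fin 4 → ℝ)
/-! ## Part I — level reduction keeping quarter-integrality -/

/-- LEVEL REDUCTION on the left pair, KEEPING QUARTER-INTEGRALITY (strong induction on `⌊a⌋ + ⌊b⌋` with the landed chains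
`P_lower_left`, `P_swap_left`; `b − 1` is a quarter-integer when `b` is). [folklore] -/
theorem P_of_base_left_quarter {a' b' : ℚ}
    (base : ∀ a b : ℚ, 0 < a → a ≤ 1 → 0 < b → b ≤ 1 → (∃ m : ℤ, a = m / 4) → (∃ m : ℤ, b = m / 4) → P⟦a, b, a', b'⟧) :
    ∀ a b : ℚ, 0 < a → 0 < b → (∃ m : ℤ, a = m / 4) → (∃ m : ℤ, b = m / 4) → P⟦a, b, a', b'⟧ := by
  have hsub : ∀ {q : ℚ}, (∃ m : ℤ, q = m / 4) → ∃ m : ℤ, q - 1 = m / 4 := by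
    rintro q ⟨m, rfl⟩
    exact ⟨m - 4, by push_cast; ring⟩
  suffices H : ∀ n : ℕ, ∀ a b : ℚ, ⌊a⌋₊ + ⌊b⌋₊ = n → 0 < a → 0 < b → (∃ m : ℤ, a = m / 4) → (∃ m : ℤ, b = m / 4) →
      P⟦a, b, a', b'⟧ from
    fun a b ha hb hma hmb => H _ a b rfl ha hb hma hmb
  intro n
  induction n using Nat.strong_induction_on with
  | _ n ih =>
    intro a b hn ha hb hma hmb
    by_cases hb1 : b ≤ 1
    · by_cases ha1 : a ≤ 1
      · exact base a b ha ha1 hb hb1 hma hmb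
      · push Not at ha1
        have ha' : 0 < a - 1 := by linarith
        have hfl : ⌊a⌋₊ = ⌊a - 1⌋₊ + 1 := by
          conv_lhs => rw [← sub_add_cancel a 1]
          exact Nat.floor_add_one ha'.le
        have hlt : ⌊b⌋₊ + ⌊a - 1⌋₊ < n := by omega
        have hP : P⟦b, (a - 1), a', b'⟧ := ih _ hlt b (a - 1) rfl hb ha' hmb (hsub hma)
        have hP' : P⟦b, a, a', b'⟧ := by simpa using P_lower_left hb ha' hP
        exact P_swap_left ha hb hP'
    · push Not at hb1
      have hb' : 0 < b - 1 := by linarith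
      have hfl : ⌊b⌋₊ = ⌊b - 1⌋₊ + 1 := by
        conv_lhs => rw [← sub_add_cancel b 1]
        exact Nat.floor_add_one hb'.le
      have hlt : ⌊a⌋₊ + ⌊b - 1⌋₊ < n := by omega
      have hP : P⟦a, (b - 1), a', b'⟧ := ih _ hlt a (b - 1) rfl ha hb' hma (hsub hmb)
      simpa using P_lower_left ha hb' hP

/-- A positive quarter-integer in `(0,1]` is `1/4`, `1/2`, `3/4` or `1`. [folklore] -/
theorem quarter_cases {a : ℚ} (ha : 0 < a) (ha1 : a ≤ 1) (hm : ∃ m : ℤ, a = m / 4) :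
    a = 1 / 4 ∨ a = 1 / 2 ∨ a = 3 / 4 ∨ a = 1 := by
  obtain ⟨m, rfl⟩ := hm
  have h1 : (0 : ℚ) < m := by linarith
  have h2 : (m : ℚ) ≤ 4 := by linarith
  have h1' : 0 < m := by exact_mod_cast h1
  have h2' : m ≤ 4 := by exact_mod_cast h2
  interval_cases m <;> norm_num

/-! ## Part II — the canonical cells, their values, and the separation of the classes -/

/-- `((1/4 : ℚ) : ℝ) = 1/4`. [folklore] -/
theorem cast_quarter : (((1 / 4 : ℚ)) : ℝ) = 1 / 4 := by norm_num
/-- `((1/2 : ℚ) : ℝ) = 1/2`. [folklore] -/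
theorem cast_half : (((1 / 2 : ℚ)) : ℝ) = 1 / 2 := by norm_num
/-- `((3/4 : ℚ) : ℝ) = 3/4`. [folklore] -/
theorem cast_threeQuarters : (((3 / 4 : ℚ)) : ℝ) = 3 / 4 := by norm_num

/-- Value of `T₀ = [β(1,1)]`: `1`. [cite: AndrewsAskeyRoy1999, Thm 1.1.4] -/
theorem value_T0 {T : IntegralRep 1} (hT : Pinned⟦(1:ℝ), (1:ℚ), (1:ℚ), T⟧) : T.value = vq 0 := by
  rw [value_of_pinned hT (by norm_num) (by norm_num)]
  norm_num [Real.Gamma_one, Real.Gamma_two]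

/-- Value of `T₁ = [β(1/2,1/2)]`: `π`. [cite: AndrewsAskeyRoy1999, Thm 1.1.4] -/
theorem value_T1 {T : IntegralRep 1} (hT : Pinned⟦(1:ℝ), (1/2:ℚ), (1/2:ℚ), T⟧) : T.value = vq 1 := by
  rw [value_of_pinned hT (by norm_num) (by norm_num), cast_half, stub_betaValuesQuarter.2.2]
  simp

/-- Value of `T₂ = [√2·β(1/4,1/2)]`: `Γ(1/4)²/√π`. [cite: AndrewsAskeyRoy1999, Thm 1.1.4] -/
theorem value_T2 {T : IntegralRep 1} (hT : Pinned⟦(Real.sqrt 2), (1/4:ℚ), (1/2:ℚ), T⟧) : T.value = vq 2 := by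
  rw [value_of_pinned hT (by norm_num) (by norm_num), cast_half, cast_quarter, stub_betaValuesQuarter.1,
    Real.sqrt_mul (by norm_num : (0:ℝ) ≤ 2)]
  have hs : Real.sqrt 2 ≠ 0 := (Real.sqrt_pos.2 (by norm_num)).ne'
  have hp : Real.sqrt Real.pi ≠ 0 := (Real.sqrt_pos.2 Real.pi_pos).ne'
  simp only [Matrix.cons_val]
  field_simp

/-- Value of `T₃ = [(4√2)⁻¹·β(3/4,1/2)]`: `π√π/Γ(1/4)²`. [cite: AndrewsAskeyRoy1999, Thm 1.1.4] -/
theorem value_T3 {T : IntegralRep 1} (hT : Pinned⟦(4 * Real.sqrt 2)⁻¹, (3/4:ℚ), (1/2:ℚ), T⟧) : T.value = vq 3 := by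
  rw [value_of_pinned hT (by norm_num) (by norm_num), cast_half, cast_threeQuarters, stub_betaValuesQuarter.2.1,
    Real.sqrt_mul (by norm_num : (0:ℝ) ≤ 2)]
  have hs : Real.sqrt 2 ≠ 0 := (Real.sqrt_pos.2 (by norm_num)).ne'
  have hΓ : Real.Gamma (1/4) ≠ 0 := (Real.Gamma_pos_of_pos (by norm_num)).ne'
  simp only [Matrix.cons_val]
  field_simp

/-- The class values are positive. [folklore] -/
theorem vq_pos (i : Fin 4) : 0 < vq i := by
  have hπ := Real.pi_pos
  have hΓ : 0 < Real.Gamma (1/4) := Real.Gamma_pos_of_pos (by norm_num)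
  have hs : 0 < Real.sqrt Real.pi := Real.sqrt_pos.2 hπ
  fin_cases i <;> simp <;> positivity

/-- SEPARATION OF THE CLASSES, ordered pairs `i < j`: `vq i` is never an algebraic multiple of `vq j` — after squaring away `√π` each
instance is a forbidden proportionality between two distinct monomials in `π`, `Γ(1/4)` (Chudnovsky, through
`Thirds.monomial_ne_algebraic_mul_monomial`). [cite: Chudnovsky1984, Ch. 7 §2 Cor. 2.3] -/
theorem vq_sep_lt (i j : Fin 4) (hij : i < j) (k : ℝ) (hk : IsAlgebraic ℚ k) : vq i ≠ k * vq j := by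
  have hAI := algebraicIndependent_real_pi_gamma_one_quarter
  have hπ := Real.pi_pos
  have hΓ : 0 < Real.Gamma (1/4) := Real.Gamma_pos_of_pos (by norm_num)
  have hπ0 : Real.pi ≠ 0 := hπ.ne'
  have hΓ0 : Real.Gamma (1/4) ≠ 0 := hΓ.ne'
  have hs : 0 < Real.sqrt Real.pi := Real.sqrt_pos.2 hπ
  have hs0 : Real.sqrt Real.pi ≠ 0 := hs.ne'
  have hs2 : Real.sqrt Real.pi ^ 2 = Real.pi := Real.sq_sqrt hπ.le
  have hk2 : IsAlgebraic ℚ (k ^ 2) := hk.pow 2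
  intro h
  fin_cases i <;> fin_cases j <;> simp at hij h
  · -- (0,1): `1 = k · π`
    exact monomial_ne_algebraic_mul_monomial hAI hk (m := 0) (n := 0) (m' := 1) (n' := 0) (by norm_num) (by simpa using h)
  · -- (0,2): `1 = k · Γ²/√π`, so `π = k² · Γ⁴`
    refine monomial_ne_algebraic_mul_monomial hAI hk2 (m := 1) (n := 0) (m' := 0) (n' := 4) (by norm_num) ?_
    field_simp at h
    have h' := congrArg (fun t : ℝ => t ^ 2) h
    simp only [pow_one, pow_zero, mul_one, one_mul]
    linear_combination h' - hs2
  · -- (0,3): `1 = k · π√π/Γ²`, so `Γ⁴ = k² · π³`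
    refine monomial_ne_algebraic_mul_monomial hAI hk2 (m := 0) (n := 4) (m' := 3) (n' := 0) (by norm_num) ?_
    field_simp at h
    have h' := congrArg (fun t : ℝ => t ^ 2) h
    simp only [pow_zero, mul_one, one_mul]
    linear_combination h' + (k ^ 2 * Real.pi ^ 2) * hs2
  · -- (1,2): `π = k · Γ²/√π`, so `π³ = k² · Γ⁴`
    refine monomial_ne_algebraic_mul_monomial hAI hk2 (m := 3) (n := 0) (m' := 0) (n' := 4) (by norm_num) ?_
    field_simp at h
    have h' := congrArg (fun t : ℝ => t ^ 2) h
    simp only [pow_zero, mul_one, one_mul]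
    linear_combination h' - (Real.pi ^ 2) * hs2
  · -- (1,3): `π = k · π√π/Γ²`, so `Γ⁴ = k² · π`
    refine monomial_ne_algebraic_mul_monomial hAI hk2 (m := 0) (n := 4) (m' := 1) (n' := 0) (by norm_num) ?_
    field_simp at h
    have h' := congrArg (fun t : ℝ => t ^ 2) h
    simp only [pow_zero, pow_one, mul_one, one_mul]
    linear_combination h' + (k ^ 2) * hs2
  · -- (2,3): `Γ²/√π = k · π√π/Γ²`, so `Γ⁴ = k · π²`
    refine monomial_ne_algebraic_mul_monomial hAI hk (m := 0) (n := 4) (m' := 2) (n' := 0) (by norm_num) ?_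
    field_simp at h
    simp only [pow_zero, mul_one, one_mul]
    linear_combination h + (k * Real.pi) * hs2

/-- SEPARATION OF THE CLASSES: for `i ≠ j`, `vq i` is not an algebraic multiple of `vq j`. [cite: Chudnovsky1984, Ch. 7 §2 Cor. 2.3] -/
theorem vq_sep (i j : Fin 4) (hij : i ≠ j) (k : ℝ) (hk : IsAlgebraic ℚ k) : vq i ≠ k * vq j := by
  rcases lt_or_gt_of_ne hij with h | h
  · exact vq_sep_lt i j h k hk
  · intro heq
    have hk0 : k ≠ 0 := by
      rintro rfl
      exact (vq_pos i).ne' (by simpa using heq)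
    refine vq_sep_lt j i h k⁻¹ hk.inv ?_
    rw [heq]
    field_simp

/-! ## Part II — normal forms -/

/-- Rule 1b on the constants, DIRECT: a cell pinned `(c, a, b)` is a chain of moves away from `(c c₀⁻¹)·T` for the canonical cell `T`
pinned `(c₀, a, b)`, `c₀ ≠ 0` real algebraic. [cite: KontsevichZagier2001, §1.2 rule (1)] -/
theorem nf_direct {c c₀ : ℝ} (hc : IsAlgebraic ℚ c) (hc₀ : IsAlgebraic ℚ c₀) (h0 : c₀ ≠ 0) {a b : ℚ} {r T : IntegralRep 1}
    (hr : Pinned⟦c, a, b, r⟧) (hT : Pinned⟦c₀, a, b, T⟧) :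
    ∃ (q : ℝ) (hk : IsAlgebraic ℚ (c * q)), 0 < q ^ 2 ∧ Equivalent r (T.constMul (c * q) hk) := by
  refine ⟨c₀⁻¹, hc.mul hc₀.inv, by positivity, ?_⟩
  exact equivalent_constMul_of_pinned (hc.mul hc₀.inv) hr hT (by field_simp)

/-- The same after a swap of the exponents (reflection move). [cite: KontsevichZagier2001, §1.2 rules (1), (2)] -/
theorem nf_swap {c c₀ : ℝ} (hc : IsAlgebraic ℚ c) (hc₀ : IsAlgebraic ℚ c₀) (h0 : c₀ ≠ 0) {a b : ℚ} (ha : 0 < a) (hb : 0 < b)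
    {r T : IntegralRep 1} (hr : Pinned⟦c, b, a, r⟧) (hT : Pinned⟦c₀, a, b, T⟧) :
    ∃ (q : ℝ) (hk : IsAlgebraic ℚ (c * q)), 0 < q ^ 2 ∧ Equivalent r (T.constMul (c * q) hk) := by
  obtain ⟨ρ, hρ⟩ := exists_pinned c hc ha hb
  have e : Equivalent r ρ := pinned_swap hc hb ha hr hρ
  obtain ⟨q, hk, hq, e'⟩ := nf_direct hc hc₀ h0 hρ hT
  exact ⟨q, hk, hq, e.trans e'⟩

/-- NORMAL FORM of the sixteen base cells: `[c·β(a,b)]`, `a, b ∈ {1/4, 1/2, 3/4, 1}`, is a chain of moves away from `(c q)·T_i` for a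
non-zero real `q` with `c q` algebraic and one of the four canonical cells `T₀ = [β(1,1)]` (rational class: `(a,1)`, `(1,b)`),
`T₁ = [β(1/2,1/2)]` (`π`-class: `(1/2,1/2)`; `(1/4,3/4)`, `(3/4,1/4)` through Euler's reflection at `1/4`), `T₂ = [√2·β(1/4,1/2)]`
(`(1/4,1/2)`, `(1/2,1/4)`; `(1/4,1/4)` through Legendre's duplication), `T₃ = [(4√2)⁻¹·β(3/4,1/2)]` (`(3/4,1/2)`, `(1/2,3/4)`; `(3/4,3/4)`
through duplication). [cite: KontsevichZagier2001, §1.2] -/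
theorem normalForm {c : ℝ} (hc : IsAlgebraic ℚ c) {a b : ℚ} (ha : a = 1 / 4 ∨ a = 1 / 2 ∨ a = 3 / 4 ∨ a = 1)
    (hb : b = 1 / 4 ∨ b = 1 / 2 ∨ b = 3 / 4 ∨ b = 1) {r : IntegralRep 1} (hr : Pinned⟦c, a, b, r⟧) (T : Fin 4 → IntegralRep 1)
    (hT0 : Pinned⟦(1 : ℝ), (1 : ℚ), (1 : ℚ), T 0⟧) (hT1 : Pinned⟦(1 : ℝ), (1/2 : ℚ), (1/2 : ℚ), T 1⟧)
    (hT2 : Pinned⟦(Real.sqrt 2), (1/4 : ℚ), (1/2 : ℚ), T 2⟧) (hT3 : Pinned⟦(4 * Real.sqrt 2)⁻¹, (3/4 : ℚ), (1/2 : ℚ), T 3⟧) :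
    ∃ (i : Fin 4) (q : ℝ) (hk : IsAlgebraic ℚ (c * q)), 0 < q ^ 2 ∧ Equivalent r ((T i).constMul (c * q) hk) := by
  have hs : 0 < Real.sqrt 2 := Real.sqrt_pos.2 (by norm_num)
  have hs0 : Real.sqrt 2 ≠ 0 := hs.ne'
  have hs2 : Real.sqrt 2 ^ 2 = 2 := Real.sq_sqrt (by norm_num)
  have h2 : IsAlgebraic ℚ (Real.sqrt 2) := by
    refine ⟨Polynomial.X ^ 2 - Polynomial.C 2, Polynomial.X_pow_sub_C_ne_zero (by norm_num) 2, ?_⟩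
    simp [hs2]
  have h4 : IsAlgebraic ℚ (4:ℝ) := by simpa using (isAlgebraic_rat ℚ 4 : IsAlgebraic ℚ (((4:ℚ)) : ℝ))
  have h42 : IsAlgebraic ℚ ((4 * Real.sqrt 2)⁻¹) := (h4.mul h2).inv
  -- the rational class: cells `(a, 1)` and `(1, b)`
  have rat_a : ∀ {a : ℚ}, 0 < a → Pinned⟦c, a, (1 : ℚ), r⟧ →
      ∃ (i : Fin 4) (q : ℝ) (hk : IsAlgebraic ℚ (c * q)), 0 < q ^ 2 ∧ Equivalent r ((T i).constMul (c * q) hk) := by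
    intro a ha0 hr1
    obtain ⟨q, hk, hq, e, -⟩ := nf_a_one hc ha0 hr1 hT0
    exact ⟨0, q, hk, by positivity, e⟩
  have rat_b : ∀ {b : ℚ}, 0 < b → Pinned⟦c, (1 : ℚ), b, r⟧ →
      ∃ (i : Fin 4) (q : ℝ) (hk : IsAlgebraic ℚ (c * q)), 0 < q ^ 2 ∧ Equivalent r ((T i).constMul (c * q) hk) := by
    intro b hb0 hr1
    obtain ⟨ρ, hρ⟩ := exists_pinned c hc hb0 (by norm_num : (0:ℚ) < 1)
    have e : Equivalent r ρ := pinned_swap hc (by norm_num) hb0 hr1 hρ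
    obtain ⟨q, hk, hq, e', -⟩ := nf_a_one hc hb0 hρ hT0
    exact ⟨0, q, hk, by positivity, e.trans e'⟩
  rcases hb with rfl | rfl | rfl | rfl
  · -- b = 1/4
    rcases ha with rfl | rfl | rfl | rfl
    · -- (1/4, 1/4): Legendre duplication onto `T₂`, `q = 1`
      obtain ⟨R, hR⟩ := exists_pinned 1 isAlgebraic_one (by norm_num : (0:ℚ) < 1/4) (by norm_num : (0:ℚ) < 1/4)
      have e₀ : Equivalent R (T 2) := by
        refine pinned_duplication (by norm_num) ?_ hR hT2
        rw [show (1 - 2 * (((1 / 4 : ℚ)) : ℝ)) = 1 / 2 by norm_num]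
        exact Real.sqrt_eq_rpow 2
      have hk : IsAlgebraic ℚ (c * 1) := by simpa using hc
      refine ⟨2, 1, hk, by norm_num, (equivalent_constMul_of_pinned hc hr hR (mul_one c).symm).trans ?_⟩
      refine (e₀.constMul c hc).trans (of_sub_of_mem_relations_of_eqOn rfl fun x _ => ?_)
      simp only [IntegralRep.integrand_constMul, mul_one]
    · -- (1/2, 1/4): swap onto `T₂`
      exact let ⟨q, hk, hq, e⟩ := nf_swap hc h2 hs0 (by norm_num) (by norm_num) hr hT2; ⟨2, q, hk, hq, e⟩
    · -- (3/4, 1/4): swap, then Euler's reflection at `1/4` onto `T₁`, `q = √2`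
      obtain ⟨ρ, hρ⟩ := exists_pinned c hc (by norm_num : (0:ℚ) < 1/4) (by norm_num : (0:ℚ) < 3/4)
      have e : Equivalent r ρ := pinned_swap hc (by norm_num) (by norm_num) hr hρ
      exact ⟨1, Real.sqrt 2, hc.mul h2, by positivity, e.trans (pinned_quarter_threeQuarter_equivalent hc h2 hρ hT1 _)⟩
    · exact rat_b (by norm_num) hr
  · -- b = 1/2
    rcases ha with rfl | rfl | rfl | rfl
    · exact let ⟨q, hk, hq, e⟩ := nf_direct hc h2 hs0 hr hT2; ⟨2, q, hk, hq, e⟩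
    · exact let ⟨q, hk, hq, e⟩ := nf_direct hc isAlgebraic_one one_ne_zero hr hT1; ⟨1, q, hk, hq, e⟩
    · exact let ⟨q, hk, hq, e⟩ := nf_direct hc h42 (by positivity) hr hT3; ⟨3, q, hk, hq, e⟩
    · exact rat_b (by norm_num) hr
  · -- b = 3/4
    rcases ha with rfl | rfl | rfl | rfl
    · -- (1/4, 3/4): Euler's reflection at `1/4` onto `T₁`
      exact ⟨1, Real.sqrt 2, hc.mul h2, by positivity, pinned_quarter_threeQuarter_equivalent hc h2 hr hT1 _⟩
    · exact let ⟨q, hk, hq, e⟩ := nf_swap hc h42 (by positivity) (by norm_num) (by norm_num) hr hT3; ⟨3, q, hk, hq, e⟩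
    · -- (3/4, 3/4): duplication `β(3/4,3/4) ∼ (√2)⁻¹β(3/4,1/2) = 4·T₃`, `q = 4`
      obtain ⟨R, hR⟩ := exists_pinned 1 isAlgebraic_one (by norm_num : (0:ℚ) < 3/4) (by norm_num : (0:ℚ) < 3/4)
      obtain ⟨D, hD⟩ := exists_pinned (Real.sqrt 2)⁻¹ h2.inv (by norm_num : (0:ℚ) < 3/4) (by norm_num : (0:ℚ) < 1/2)
      have e₀ : Equivalent R D := by
        refine pinned_duplication (by norm_num) ?_ hR hD
        rw [show (1 - 2 * (((3 / 4 : ℚ)) : ℝ)) = -(1 / 2) by norm_num, Real.rpow_neg (by norm_num : (0:ℝ) ≤ 2),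
          ← Real.sqrt_eq_rpow]
      have e₁ : Equivalent D ((T 3).constMul 4 h4) := by
        refine equivalent_constMul_of_pinned h4 hD hT3 ?_
        rw [mul_inv, ← mul_assoc, mul_inv_cancel₀ (by norm_num : (4:ℝ) ≠ 0), one_mul]
      have hk : IsAlgebraic ℚ (c * 4) := hc.mul h4
      refine ⟨3, 4, hk, by norm_num, (equivalent_constMul_of_pinned hc hr hR (mul_one c).symm).trans ?_⟩
      refine ((e₀.trans e₁).constMul c hc).trans (of_sub_of_mem_relations_of_eqOn rfl fun x _ => ?_)
      simp only [IntegralRep.integrand_constMul]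
      ring
    · exact rat_b (by norm_num) hr
  · -- b = 1
    rcases ha with rfl | rfl | rfl | rfl <;> exact rat_a (by norm_num) hr

/-! ## Part II — the base of the quarter-integer sector and the assembly -/

/-- **The base of the quarter-integer sector**: `P⟦a, b, a', b'⟧` for all exponents in `{1/4, 1/2, 3/4, 1}`. [cite: KontsevichZagier2001, §1.2]
[cite: Chudnovsky1984, Ch. 7 §2 Cor. 2.3] -/
theorem P_base_quarter {a b a' b' : ℚ} (ha : a = 1 / 4 ∨ a = 1 / 2 ∨ a = 3 / 4 ∨ a = 1) (hb : b = 1 / 4 ∨ b = 1 / 2 ∨ b = 3 / 4 ∨ b = 1)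
    (ha' : a' = 1 / 4 ∨ a' = 1 / 2 ∨ a' = 3 / 4 ∨ a' = 1) (hb' : b' = 1 / 4 ∨ b' = 1 / 2 ∨ b' = 3 / 4 ∨ b' = 1) : P⟦a, b, a', b'⟧ := by
  have hpos : ∀ {q : ℚ}, (q = 1 / 4 ∨ q = 1 / 2 ∨ q = 3 / 4 ∨ q = 1) → 0 < q := by
    rintro q (rfl | rfl | rfl | rfl) <;> norm_num
  intro c c' r r' hc hc' hr hr' hv
  have hvr := value_of_pinned hr (hpos ha) (hpos hb)
  have hvr' := value_of_pinned hr' (hpos ha') (hpos hb')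
  have hBpos : ∀ {p q : ℚ}, 0 < p → 0 < q →
      0 < Real.Gamma (p:ℝ) * Real.Gamma (q:ℝ) / Real.Gamma ((p:ℝ) + (q:ℝ)) := fun {p q} hp hq => by
    have hpR : (0:ℝ) < p := by exact_mod_cast hp
    have hqR : (0:ℝ) < q := by exact_mod_cast hq
    exact div_pos (mul_pos (Real.Gamma_pos_of_pos hpR) (Real.Gamma_pos_of_pos hqR)) (Real.Gamma_pos_of_pos (by linarith))
  -- the degenerate constants
  by_cases hc0 : c = 0
  · have hc'0 : c' = 0 := by
      have h0 : c' * (Real.Gamma (a':ℝ) * Real.Gamma (b':ℝ) / Real.Gamma ((a':ℝ) + (b':ℝ))) = 0 := by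
        rw [← hvr', ← hv, hvr, hc0, zero_mul]
      exact (mul_eq_zero.1 h0).resolve_right (hBpos (hpos ha') (hpos hb')).ne'
    have h1 : of r ∈ relations := of_mem_relations_of_eqOn_zero r fun x hx => by
      rw [hr.2 hx]
      simp [hc0]
    have h2 : of r' ∈ relations := of_mem_relations_of_eqOn_zero r' fun x hx => by
      rw [hr'.2 hx]
      simp [hc'0]
    exact relations.sub_mem h1 h2
  have hc'0 : c' ≠ 0 := by
    intro h
    have h0 : c * (Real.Gamma (a:ℝ) * Real.Gamma (b:ℝ) / Real.Gamma ((a:ℝ) + (b:ℝ))) = 0 := by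
      rw [← hvr, hv, hvr', h, zero_mul]
    exact hc0 ((mul_eq_zero.1 h0).resolve_right (hBpos (hpos ha) (hpos hb)).ne')
  -- the four canonical cells
  have hs2 : Real.sqrt 2 ^ 2 = 2 := Real.sq_sqrt (by norm_num)
  have h2 : IsAlgebraic ℚ (Real.sqrt 2) := by
    refine ⟨Polynomial.X ^ 2 - Polynomial.C 2, Polynomial.X_pow_sub_C_ne_zero (by norm_num) 2, ?_⟩
    simp [hs2]
  have h4 : IsAlgebraic ℚ (4:ℝ) := by simpa using (isAlgebraic_rat ℚ 4 : IsAlgebraic ℚ (((4:ℚ)) : ℝ))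
  have h42 : IsAlgebraic ℚ ((4 * Real.sqrt 2)⁻¹) := (h4.mul h2).inv
  obtain ⟨T0, hT0⟩ := exists_pinned (1 : ℝ) isAlgebraic_one (by norm_num : (0:ℚ) < 1) (by norm_num : (0:ℚ) < 1)
  obtain ⟨T1, hT1⟩ := exists_pinned (1 : ℝ) isAlgebraic_one (by norm_num : (0:ℚ) < 1/2) (by norm_num : (0:ℚ) < 1/2)
  obtain ⟨T2, hT2⟩ := exists_pinned (Real.sqrt 2) h2 (by norm_num : (0:ℚ) < 1/4) (by norm_num : (0:ℚ) < 1/2)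
  obtain ⟨T3, hT3⟩ := exists_pinned (4 * Real.sqrt 2)⁻¹ h42 (by norm_num : (0:ℚ) < 3/4) (by norm_num : (0:ℚ) < 1/2)
  have hTv : ∀ i : Fin 4, (![T0, T1, T2, T3] i).value = vq i := by
    intro i
    fin_cases i
    · exact value_T0 hT0
    · exact value_T1 hT1
    · exact value_T2 hT2
    · exact value_T3 hT3
  obtain ⟨i, q, hk, hq, e⟩ := normalForm hc ha hb hr ![T0, T1, T2, T3] hT0 hT1 hT2 hT3
  obtain ⟨i', q', hk', hq', e'⟩ := normalForm hc' ha' hb' hr' ![T0, T1, T2, T3] hT0 hT1 hT2 hT3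
  have hval : r.value = c * q * vq i := by rw [Equivalent.value_eq_holds e, IntegralRep.value_constMul, hTv]
  have hval' : r'.value = c' * q' * vq i' := by rw [Equivalent.value_eq_holds e', IntegralRep.value_constMul, hTv]
  have h := hv
  rw [hval, hval'] at h
  by_cases hii : i = i'
  · -- same class: the same multiple of the same canonical cell
    subst hii
    have hcq : c * q = c' * q' := mul_right_cancel₀ (vq_pos i).ne' h
    have emid : Equivalent ((![T0, T1, T2, T3] i).constMul (c * q) hk) ((![T0, T1, T2, T3] i).constMul (c' * q') hk') :=
      of_sub_of_mem_relations_of_eqOn rfl fun x _ => by simp only [IntegralRep.integrand_constMul, hcq]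
    exact e.trans (emid.trans e'.symm)
  · -- different classes: Chudnovsky
    exfalso
    have hq0 : q ≠ 0 := by rintro rfl; simp at hq
    have hcq0 : c * q ≠ 0 := mul_ne_zero hc0 hq0
    refine vq_sep i i' hii (c' * q' * (c * q)⁻¹) (hk'.mul hk.inv) ?_
    rw [← inv_mul_cancel_left₀ hcq0 (vq i), h]
    ring

/-- **`P⟦a, b, a', b'⟧` on the whole quarter-integer sector.** [folklore] -/
theorem P_all_quarter {a b a' b' : ℚ} (ha : 0 < a) (hb : 0 < b) (ha' : 0 < a') (hb' : 0 < b')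
    (hma : ∃ m : ℤ, a = m / 4) (hmb : ∃ m : ℤ, b = m / 4) (hma' : ∃ m : ℤ, a' = m / 4) (hmb' : ∃ m : ℤ, b' = m / 4) :
    P⟦a, b, a', b'⟧ := by
  refine P_of_base_left_quarter (fun a₀ b₀ ha₀ ha₀1 hb₀ hb₀1 hma₀ hmb₀ => ?_) a b ha hb hma hmb
  refine P_symm (P_of_base_left_quarter (a' := a₀) (b' := b₀)
    (fun a₁ b₁ ha₁ ha₁1 hb₁ hb₁1 hma₁ hmb₁ => ?_) a' b' ha' hb' hma' hmb')
  exact P_base_quarter (quarter_cases ha₁ ha₁1 hma₁) (quarter_cases hb₁ hb₁1 hmb₁) (quarter_cases ha₀ ha₀1 hma₀)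
    (quarter_cases hb₀ hb₀1 hmb₀)

/-- **`BetaLinearSector` ON THE QUARTER-INTEGER SECTOR, UNCONDITIONALLY**: Conjecture 1 of Kontsevich–Zagier for every pair of Beta
integrals `[∫₀¹ t^{a-1}(1-t)^{b-1}dt]`, `[∫₀¹ c·t^{a'-1}(1-t)^{b'-1}dt]` with `a, b, a', b' ∈ ¼ℕ_{>0}`, `c` real algebraic, and equal
values — the registered anchor `betaLinearSector_quarters` of crux stmt-3897.  Inputs: the landed chains and the betaFirst move, Euler's
reflection at `1/4` and Legendre's duplication inside the calculus (BRIDGES file), the closed forms `stub_betaValuesQuarter`, and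
Chudnovsky's theorem (`algebraicIndependent_real_pi_gamma_one_quarter`). [cite: KontsevichZagier2001, §1.2] [cite: Chudnovsky1984, Ch. 7 §2 Cor. 2.3] -/
theorem betaLinearSector_quarters : ∀ (a b a' b' : ℚ) (c : ℝ), 0 < a → 0 < b → 0 < a' → 0 < b' → IsAlgebraic ℚ c →
    (∃ m : ℤ, a = m / 4) → (∃ m : ℤ, b = m / 4) → (∃ m : ℤ, a' = m / 4) → (∃ m : ℤ, b' = m / 4) →
    ∀ (r r' : KZ.IntegralRep 1), r.domain = {x | x 0 ∈ Set.Ioo (0:ℝ) 1} →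
    Set.EqOn r.integrand (fun x => (x 0) ^ ((a:ℝ) - 1) * (1 - x 0) ^ ((b:ℝ) - 1)) r.domain →
    r'.domain = {x | x 0 ∈ Set.Ioo (0:ℝ) 1} →
    Set.EqOn r'.integrand (fun x => c * (x 0) ^ ((a':ℝ) - 1) * (1 - x 0) ^ ((b':ℝ) - 1)) r'.domain →
    r.value = r'.value → KZ.Equivalent r r' := by
  intro a b a' b' c ha hb ha' hb' hc hma hmb hma' hmb' r r' hd hi hd' hi' hv
  refine P_all_quarter ha hb ha' hb' hma hmb hma' hmb' 1 c r r' isAlgebraic_one hc ⟨hd, fun x hx => ?_⟩ ⟨hd', hi'⟩ hv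
  simp only [hi hx, one_mul]

end Summit.KontsevichZagierPeriods.FermatIsogeny.BetaLinearSector.Quarters
end
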